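import Literature.MathematicalPhysics.QuantumFieldTheory.QCDSiteRPAction
import Literature.MathematicalPhysics.QuantumFieldTheory.QCDTorusTranslation
import Literature.MathematicalPhysics.QuantumFieldTheory.LatticeGaugeStaticPotentialProofs
import Literature.MathematicalPhysics.QuantumLattice.GrassmannGaussianSymmetry
import Literature.MathematicalPhysics.QuantumLattice.GrassmannIntegralSubstitution
import Literature.MathematicalPhysics.QuantumLattice.GrassmannRelabelling
import Literature.MathematicalPhysics.QuantumLattice.GrassmannIntegralProofs
import HarnessLib

/-!
# Covariance of the Wilson–Dirac operator and of the honest lattice-QCD functional under permutations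
of the coordinate axes

Topic `MathematicalPhysics/QuantumFieldTheory` (families `constructive-qft`, `yang-mills`); sequel of
`LatticeGaugeStaticPotentialProofs` §(B) (`configPerm π`: `(π·U)(x, i) = U(π⁻¹x, π⁻¹i)`; the torus Wilson state is
invariant, `wilsonMeasure_map_configPerm`), `QCDTorusTranslation` (translations; `det_funLeft_perm'`) and `QCDSiteRPAction`
(`spinBlock_mul_apply`, `mul_spinBlock_apply`).

A permutation `π` of the four Euclidean axes is a symmetry of Wilson's lattice QCD once the quark spinors are
rotated by a matrix `S` implementing it on the Clifford generators, `S γ_μ S⁻¹ = γ_{π μ}` (Montvay–Münster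
§4.2 (4.31)–(4.35) and App. A: the hypercubic group acts on Dirac spinors through the Clifford algebra).

* `wilsonDirac_configPerm_apply` — **covariance of the Wilson–Dirac operator**: for every intertwiner
  `(S, S⁻¹)` of `π`, `D_W[π·U]((πx,a,·),(πy,b,·)) = S · D_W[U]((x,a,·),(y,b,·)) · S⁻¹` (4 × 4 spin blocks);
* `transpositionSpinor μ ν = γ₅ (γ_μ − γ_ν)` with inverse `(γ_μ − γ_ν) γ₅ / 2` intertwines the transposition
  `(μ ν)` (`transpositionSpinor_intertwines`, checked on the explicit chiral-basis matrices; all permutations follow by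
  `IsSpinorIntertwiner.trans`);
* `diracMatrix_configPerm` — the `N_f`-flavour matrix identity
  `D[π·U] = ((1⊗S) D[U] (1⊗S⁻¹)) ∘ (π⁻¹ × π⁻¹)`;
* `quarkAxisPerm π S S⁻¹` — the algebra automorphism of `FermiAlg N_f S` (site relabelling by `π` after the spin
  block substitution `ψ̄ ↦ ψ̄(1⊗S)`, `ψ ↦ (1⊗S⁻¹)ψ`), with `quarkAxisPerm_fermiBoltzmann`
  (`e^{−ψ̄D[U]ψ} ↦ e^{−ψ̄D[π·U]ψ}`) and `fermiIntegral_quarkAxisPerm` (unit Berezin Jacobian);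
* `qcdTorusExpect_quarkAxisPerm` — **covariance of the honest signed functional**:
  `⟨(π,S) · X(π⁻¹ ·)⟩_{β,S,m} = ⟨X⟩_{β,S,m}` for every Grassmann-valued `X`, every `β`, all bare masses.

This is the hypercubic-covariance input (M4 of the audits of items AnomalyRigidity.UniformGapTreeDecay /
HeatSlicedQuarks.RobustYangMillsHandover) that turns Euclidean-TIME clustering of `qcdTorusExpect` into clustering
along any axis.  References: Montvay–Münster 1994 §4.2, App. A [MontvayMunster1994]; Osterwalder–Seiler 1978 §2
[OsterwalderSeiler1978]; Berezin 1966 Ch. I §3 [BerezinSecondQuant1966].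
-/

noncomputable section

open MeasureTheory
open Literature.MathematicalPhysics.QuantumLattice Literature.Probability.LatticeModels GrassmannAlgebra
open scoped Matrix

namespace Literature.MathematicalPhysics.QuantumFieldTheory

/-! ### Spinor intertwiners of axis permutations -/

/-- `(S, S')` **intertwines** the axis permutation `π` on the Euclidean Clifford generators:
`S γ_μ S' = γ_{π μ}` for all `μ`, and `S S' = 1`. [cite: MontvayMunster1994, §4.2 and App. A] -/
def IsSpinorIntertwiner (π : Equiv.Perm (Fin 4)) (S S' : Matrix (Fin 4) (Fin 4) ℂ) : Prop :=
  (∀ μ : Fin 4, S * euclideanGamma μ * S' = euclideanGamma (π μ)) ∧ S * S' = 1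

/-- `γ₅ = diag(1, 1, −1, −1)` as an explicit matrix. [cite: MontvayMunster1994, App. A] -/
theorem gammaFive_eq_explicit : gammaFive = !![1, 0, 0, 0; 0, 1, 0, 0; 0, 0, -1, 0; 0, 0, 0, -1] := by
  rw [gammaFive_eq_diagonal]
  ext i j
  fin_cases i <;> fin_cases j <;> simp [Matrix.diagonal]

/-- The (unnormalised) spinor matrix of the transposition of the axes `μ ≠ ν`: `γ₅ (γ_μ − γ_ν)`, with inverse
`(γ_μ − γ_ν) γ₅ / 2`. [cite: MontvayMunster1994, App. A] -/
def transpositionSpinor (μ ν : Fin 4) : Matrix (Fin 4) (Fin 4) ℂ :=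
  gammaFive * (euclideanGamma μ - euclideanGamma ν)

/-- The inverse spinor matrix of the transposition. [cite: MontvayMunster1994, App. A] -/
def transpositionSpinorInv (μ ν : Fin 4) : Matrix (Fin 4) (Fin 4) ℂ :=
  (2 : ℂ)⁻¹ • ((euclideanGamma μ - euclideanGamma ν) * gammaFive)

/-- Intertwiners compose. [folklore] -/
theorem IsSpinorIntertwiner.trans {π₁ π₂ : Equiv.Perm (Fin 4)} {S₁ S₁' S₂ S₂' : Matrix (Fin 4) (Fin 4) ℂ}
    (h₁ : IsSpinorIntertwiner π₁ S₁ S₁') (h₂ : IsSpinorIntertwiner π₂ S₂ S₂') :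
    IsSpinorIntertwiner (π₁.trans π₂) (S₂ * S₁) (S₁' * S₂') := by
  refine ⟨fun μ => ?_, ?_⟩
  · rw [Equiv.trans_apply, ← h₂.1 (π₁ μ), ← h₁.1 μ]
    simp only [Matrix.mul_assoc]
  · rw [Matrix.mul_assoc, ← Matrix.mul_assoc S₁, h₁.2, Matrix.one_mul, h₂.2]

/-- The identity intertwines the identity. [folklore] -/
theorem IsSpinorIntertwiner.refl : IsSpinorIntertwiner (Equiv.refl (Fin 4)) 1 1 :=
  ⟨fun μ => by rw [Matrix.one_mul, Matrix.mul_one, Equiv.refl_apply], Matrix.one_mul _⟩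

/-- Negating both matrices keeps an intertwiner. [folklore] -/
theorem IsSpinorIntertwiner.neg {π : Equiv.Perm (Fin 4)} {S S' : Matrix (Fin 4) (Fin 4) ℂ}
    (h : IsSpinorIntertwiner π S S') : IsSpinorIntertwiner π (-S) (-S') :=
  ⟨fun μ => by rw [Matrix.neg_mul, Matrix.neg_mul, Matrix.mul_neg, neg_neg, h.1 μ],
    by rw [Matrix.neg_mul, Matrix.mul_neg, neg_neg, h.2]⟩

/-- The transposition spinor is antisymmetric in the two axes. [folklore] -/
theorem transpositionSpinor_swap (μ ν : Fin 4) : transpositionSpinor ν μ = -transpositionSpinor μ ν := by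
  rw [transpositionSpinor, transpositionSpinor, ← Matrix.mul_neg, neg_sub]

/-- The inverse transposition spinor is antisymmetric in the two axes. [folklore] -/
theorem transpositionSpinorInv_swap (μ ν : Fin 4) : transpositionSpinorInv ν μ = -transpositionSpinorInv μ ν := by
  rw [transpositionSpinorInv, transpositionSpinorInv, ← smul_neg, ← Matrix.neg_mul, neg_sub]

/-- The `4 × 4` identity as an explicit matrix. [folklore] -/
theorem one_fin_four' : (1 : Matrix (Fin 4) (Fin 4) ℂ) = !![1, 0, 0, 0; 0, 1, 0, 0; 0, 0, 1, 0; 0, 0, 0, 1] := by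
  ext i j
  fin_cases i <;> fin_cases j <;> rfl

section Transpositions

/-- The transposition `(0 1)`. [cite: MontvayMunster1994, App. A] -/
theorem transpositionSpinor_intertwines_01 :
    IsSpinorIntertwiner (Equiv.swap 0 1) (transpositionSpinor 0 1) (transpositionSpinorInv 0 1) := by
  refine ⟨fun ρ' => ?_, ?_⟩
  · fin_cases ρ' <;>
      simp only [transpositionSpinor, transpositionSpinorInv, Fin.reduceFinMk, Fin.isValue, Fin.zero_eta,
        Fin.mk_one, Equiv.swap_apply_left, Equiv.swap_apply_right, Equiv.swap_apply_def, Fin.reduceEq,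
        ↓reduceIte, gammaFive_eq_explicit, euclideanGamma_zero, euclideanGamma_one, euclideanGamma_two,
        euclideanGamma_three] <;>
      norm_num [ofNat_fin_four, Complex.ext_iff]
  · rw [one_fin_four']
    simp only [transpositionSpinor, transpositionSpinorInv, gammaFive_eq_explicit, euclideanGamma_zero,
      euclideanGamma_one]
    norm_num [Complex.ext_iff]

/-- The transposition `(0 2)`. [cite: MontvayMunster1994, App. A] -/
theorem transpositionSpinor_intertwines_02 :
    IsSpinorIntertwiner (Equiv.swap 0 2) (transpositionSpinor 0 2) (transpositionSpinorInv 0 2) := by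
  refine ⟨fun ρ' => ?_, ?_⟩
  · fin_cases ρ' <;>
      simp only [transpositionSpinor, transpositionSpinorInv, Fin.reduceFinMk, Fin.isValue, Fin.zero_eta,
        Fin.mk_one, Equiv.swap_apply_left, Equiv.swap_apply_right, Equiv.swap_apply_def, Fin.reduceEq,
        ↓reduceIte, gammaFive_eq_explicit, euclideanGamma_zero, euclideanGamma_one, euclideanGamma_two,
        euclideanGamma_three] <;>
      norm_num [ofNat_fin_four, Complex.ext_iff]
  · rw [one_fin_four']
    simp only [transpositionSpinor, transpositionSpinorInv, gammaFive_eq_explicit, euclideanGamma_zero,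
      euclideanGamma_two]
    norm_num [Complex.ext_iff]

/-- The transposition `(0 3)`. [cite: MontvayMunster1994, App. A] -/
theorem transpositionSpinor_intertwines_03 :
    IsSpinorIntertwiner (Equiv.swap 0 3) (transpositionSpinor 0 3) (transpositionSpinorInv 0 3) := by
  refine ⟨fun ρ' => ?_, ?_⟩
  · fin_cases ρ' <;>
      simp only [transpositionSpinor, transpositionSpinorInv, Fin.reduceFinMk, Fin.isValue, Fin.zero_eta,
        Fin.mk_one, Equiv.swap_apply_left, Equiv.swap_apply_right, Equiv.swap_apply_def, Fin.reduceEq,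
        ↓reduceIte, gammaFive_eq_explicit, euclideanGamma_zero, euclideanGamma_one, euclideanGamma_two,
        euclideanGamma_three] <;>
      norm_num [ofNat_fin_four, Complex.ext_iff]
  · rw [one_fin_four']
    simp only [transpositionSpinor, transpositionSpinorInv, gammaFive_eq_explicit, euclideanGamma_zero,
      euclideanGamma_three]
    norm_num [Complex.ext_iff]

/-- The transposition `(1 2)`. [cite: MontvayMunster1994, App. A] -/
theorem transpositionSpinor_intertwines_12 :
    IsSpinorIntertwiner (Equiv.swap 1 2) (transpositionSpinor 1 2) (transpositionSpinorInv 1 2) := by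
  refine ⟨fun ρ' => ?_, ?_⟩
  · fin_cases ρ' <;>
      simp only [transpositionSpinor, transpositionSpinorInv, Fin.reduceFinMk, Fin.isValue, Fin.zero_eta,
        Fin.mk_one, Equiv.swap_apply_left, Equiv.swap_apply_right, Equiv.swap_apply_def, Fin.reduceEq,
        ↓reduceIte, gammaFive_eq_explicit, euclideanGamma_zero, euclideanGamma_one, euclideanGamma_two,
        euclideanGamma_three] <;>
      norm_num [ofNat_fin_four, Complex.ext_iff]
  · rw [one_fin_four']
    simp only [transpositionSpinor, transpositionSpinorInv, gammaFive_eq_explicit, euclideanGamma_one,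
      euclideanGamma_two]
    norm_num [Complex.ext_iff]

/-- The transposition `(1 3)`. [cite: MontvayMunster1994, App. A] -/
theorem transpositionSpinor_intertwines_13 :
    IsSpinorIntertwiner (Equiv.swap 1 3) (transpositionSpinor 1 3) (transpositionSpinorInv 1 3) := by
  refine ⟨fun ρ' => ?_, ?_⟩
  · fin_cases ρ' <;>
      simp only [transpositionSpinor, transpositionSpinorInv, Fin.reduceFinMk, Fin.isValue, Fin.zero_eta,
        Fin.mk_one, Equiv.swap_apply_left, Equiv.swap_apply_right, Equiv.swap_apply_def, Fin.reduceEq,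
        ↓reduceIte, gammaFive_eq_explicit, euclideanGamma_zero, euclideanGamma_one, euclideanGamma_two,
        euclideanGamma_three] <;>
      norm_num [ofNat_fin_four, Complex.ext_iff]
  · rw [one_fin_four']
    simp only [transpositionSpinor, transpositionSpinorInv, gammaFive_eq_explicit, euclideanGamma_one,
      euclideanGamma_three]
    norm_num [Complex.ext_iff]

/-- The transposition `(2 3)`. [cite: MontvayMunster1994, App. A] -/
theorem transpositionSpinor_intertwines_23 :
    IsSpinorIntertwiner (Equiv.swap 2 3) (transpositionSpinor 2 3) (transpositionSpinorInv 2 3) := by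
  refine ⟨fun ρ' => ?_, ?_⟩
  · fin_cases ρ' <;>
      simp only [transpositionSpinor, transpositionSpinorInv, Fin.reduceFinMk, Fin.isValue, Fin.zero_eta,
        Fin.mk_one, Equiv.swap_apply_left, Equiv.swap_apply_right, Equiv.swap_apply_def, Fin.reduceEq,
        ↓reduceIte, gammaFive_eq_explicit, euclideanGamma_zero, euclideanGamma_one, euclideanGamma_two,
        euclideanGamma_three] <;>
      norm_num [ofNat_fin_four, Complex.ext_iff]
  · rw [one_fin_four']
    simp only [transpositionSpinor, transpositionSpinorInv, gammaFive_eq_explicit, euclideanGamma_two,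
      euclideanGamma_three]
    norm_num [Complex.ext_iff]

end Transpositions

/-- Swapping the two axes keeps the intertwining property. [folklore] -/
theorem transpositionSpinor_intertwines_symm {a b : Fin 4}
    (hab : IsSpinorIntertwiner (Equiv.swap a b) (transpositionSpinor a b) (transpositionSpinorInv a b)) :
    IsSpinorIntertwiner (Equiv.swap b a) (transpositionSpinor b a) (transpositionSpinorInv b a) := by
  rw [Equiv.swap_comm, transpositionSpinor_swap, transpositionSpinorInv_swap]
  exact hab.neg

/-- **`(γ₅(γ_μ − γ_ν), (γ_μ − γ_ν)γ₅/2)` intertwines the transposition `(μ ν)`** for all `μ ≠ ν` (checked on the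
explicit chiral-basis matrices, six base cases and antisymmetry). [cite: MontvayMunster1994, App. A] -/
theorem transpositionSpinor_intertwines : ∀ {μ ν : Fin 4}, μ ≠ ν →
    IsSpinorIntertwiner (Equiv.swap μ ν) (transpositionSpinor μ ν) (transpositionSpinorInv μ ν)
  | 0, 0, h => absurd rfl h
  | 0, 1, _ => transpositionSpinor_intertwines_01
  | 0, 2, _ => transpositionSpinor_intertwines_02
  | 0, 3, _ => transpositionSpinor_intertwines_03
  | 1, 0, _ => transpositionSpinor_intertwines_symm transpositionSpinor_intertwines_01
  | 1, 1, h => absurd rfl h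
  | 1, 2, _ => transpositionSpinor_intertwines_12
  | 1, 3, _ => transpositionSpinor_intertwines_13
  | 2, 0, _ => transpositionSpinor_intertwines_symm transpositionSpinor_intertwines_02
  | 2, 1, _ => transpositionSpinor_intertwines_symm transpositionSpinor_intertwines_12
  | 2, 2, h => absurd rfl h
  | 2, 3, _ => transpositionSpinor_intertwines_23
  | 3, 0, _ => transpositionSpinor_intertwines_symm transpositionSpinor_intertwines_03
  | 3, 1, _ => transpositionSpinor_intertwines_symm transpositionSpinor_intertwines_13
  | 3, 2, _ => transpositionSpinor_intertwines_symm transpositionSpinor_intertwines_23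
  | 3, 3, h => absurd rfl h

/-! ### Covariance of the Wilson–Dirac operator -/

section WilsonDirac

variable {L N : ℕ} [NeZero L] {G : Type*} [Group G] [MeasurableSpace G] (ρ : G →* Matrix (Fin N) (Fin N) ℂ)

omit [NeZero L] [Group G] [MeasurableSpace G] in
/-- `sitePerm π.symm` undoes `sitePerm π`. [folklore] -/
theorem sitePerm_symm_sitePerm (π : Equiv.Perm (Fin 4)) (x : TorusSite 4 L) : sitePerm π.symm (sitePerm π x) = x := by
  funext j
  simp only [sitePerm_apply, Equiv.symm_symm, Equiv.symm_apply_apply]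

omit [NeZero L] [MeasurableSpace G] in
/-- The `4 × 4` spin block of the Wilson–Dirac operator between the quark variables at `(x, a)` and `(y, b)`, written in
terms of the Clifford generators. [cite: Wilson1975] [cite: MontvayMunster1994, §4.2.2 (4.85)] -/
theorem wilsonDirac_block (U : GaugeConfig 4 L G) (m r : ℝ) (x y : TorusSite 4 L) (a b : Fin N) :
    (Matrix.of fun α β => wilsonDirac ρ U m r (x, a, α) (y, b, β)) =
      (if x = y ∧ a = b then ((m + 4 * r : ℝ) : ℂ) else 0) • (1 : Matrix (Fin 4) (Fin 4) ℂ) -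
        (1 / 2 : ℂ) • ∑ μ : Fin 4,
          ((if y = QuantumFieldTheory.Site.shift x μ then ρ (U (x, μ)) a b else 0) • ((r : ℂ) • (1 : Matrix (Fin 4) (Fin 4) ℂ) - euclideanGamma μ) +
            (if x = QuantumFieldTheory.Site.shift y μ then ρ (U (y, μ))⁻¹ a b else 0) • ((r : ℂ) • (1 : Matrix (Fin 4) (Fin 4) ℂ) + euclideanGamma μ)) := by
  ext α β
  simp only [Matrix.of_apply, wilsonDirac, Matrix.sub_apply, Matrix.smul_apply, Matrix.one_apply, Matrix.sum_apply,
    Matrix.add_apply, smul_eq_mul, Prod.mk.injEq]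
  congr 1
  · by_cases hxy : x = y <;> by_cases hab : a = b <;> by_cases hαβ : α = β <;> simp [hxy, hab, hαβ]
  · congr 1
    refine Finset.sum_congr rfl fun μ _ => ?_
    by_cases h1 : y = QuantumFieldTheory.Site.shift x μ <;> by_cases h2 : x = QuantumFieldTheory.Site.shift y μ
    · simp only [if_pos h1, if_pos h2]; ring
    · simp only [if_pos h1, if_neg h2]; ring
    · simp only [if_neg h1, if_pos h2]; ring
    · simp only [if_neg h1, if_neg h2]; ring

omit [NeZero L] in
/-- **Covariance of the Wilson–Dirac operator under a permutation of the axes**: for every spinor intertwiner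
`(S, S')` of `π`, the spin block of `D_W[π·U]` between `(πx, a)` and `(πy, b)` is `S · (spin block of D_W[U] between
(x, a), (y, b)) · S'`. [cite: MontvayMunster1994, §4.2 (4.31)–(4.35) and App. A] -/
theorem wilsonDirac_configPerm_block {π : Equiv.Perm (Fin 4)} {S S' : Matrix (Fin 4) (Fin 4) ℂ}
    (hS : IsSpinorIntertwiner π S S') (U : GaugeConfig 4 L G) (m r : ℝ) (x y : TorusSite 4 L) (a b : Fin N) :
    (Matrix.of fun α β => wilsonDirac ρ (configPerm π U) m r (sitePerm π x, a, α) (sitePerm π y, b, β)) =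
      S * (Matrix.of fun α β => wilsonDirac ρ U m r (x, a, α) (y, b, β)) * S' := by
  rw [wilsonDirac_block, wilsonDirac_block]
  -- the conditions and links of the permuted operator
  have hinj : ∀ x y : TorusSite 4 L, sitePerm π x = sitePerm π y ↔ x = y := fun x y => (sitePerm π).injective.eq_iff
  have hsh : ∀ (x y : TorusSite 4 L) (μ : Fin 4),
      (sitePerm π y = QuantumFieldTheory.Site.shift (sitePerm π x) μ ↔ y = QuantumFieldTheory.Site.shift x (π.symm μ)) := by
    intro x y μ
    rw [show QuantumFieldTheory.Site.shift (sitePerm π x) μ = sitePerm π (QuantumFieldTheory.Site.shift x (π.symm μ)) by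
      rw [sitePerm_shift, Equiv.apply_symm_apply], hinj]
  have hU : ∀ (x : TorusSite 4 L) (μ : Fin 4), configPerm π U (sitePerm π x, μ) = U (x, π.symm μ) := by
    intro x μ
    rw [configPerm_apply, sitePerm_symm_sitePerm]
  simp only [hinj, hsh, hU]
  -- reindex the direction sum on the left by `π`
  rw [← Equiv.sum_comp π.symm.symm]
  simp only [Equiv.symm_symm, Equiv.symm_apply_apply]
  -- conjugate the right-hand side
  rw [Matrix.mul_sub, Matrix.sub_mul, Matrix.mul_smul, Matrix.smul_mul, Matrix.mul_one, hS.2, Matrix.mul_smul,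
    Matrix.smul_mul, Finset.mul_sum, Finset.sum_mul]
  congr 2
  refine Finset.sum_congr rfl fun μ _ => ?_
  rw [Matrix.mul_add, Matrix.add_mul, Matrix.mul_smul, Matrix.smul_mul, Matrix.mul_smul, Matrix.smul_mul,
    Matrix.mul_sub, Matrix.sub_mul, Matrix.mul_add, Matrix.add_mul, Matrix.mul_smul, Matrix.smul_mul, Matrix.mul_one,
    hS.2, hS.1 μ]

omit [NeZero L] in
/-- Entrywise form of `wilsonDirac_configPerm_block`. [cite: MontvayMunster1994, §4.2 and App. A] -/
theorem wilsonDirac_configPerm_apply {π : Equiv.Perm (Fin 4)} {S S' : Matrix (Fin 4) (Fin 4) ℂ}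
    (hS : IsSpinorIntertwiner π S S') (U : GaugeConfig 4 L G) (m r : ℝ) (x y : TorusSite 4 L) (a b : Fin N)
    (α β : Fin 4) :
    wilsonDirac ρ (configPerm π U) m r (sitePerm π x, a, α) (sitePerm π y, b, β) =
      ∑ α', ∑ β', S α α' * wilsonDirac ρ U m r (x, a, α') (y, b, β') * S' β' β := by
  have h := congrFun (congrFun (wilsonDirac_configPerm_block ρ hS U m r x y a b) α) β
  simp only [Matrix.of_apply, Matrix.mul_apply, Finset.sum_mul] at h
  rw [h, Finset.sum_comm]

end WilsonDirac

/-! ### The `N_f`-flavour matrix identity and the Grassmann-level symmetry -/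

section Flavours

variable {Nf L : ℕ} [NeZero L]

local notation "𝔾" => Matrix.specialUnitaryGroup (Fin 3) ℂ

variable (Nf) in
/-- The permutation of the enumerated quark variables induced by `x ↦ π·x` on the site. [folklore] -/
def quarkSitePerm (π : Equiv.Perm (Fin 4)) : FermiIdx Nf L ≃ FermiIdx Nf L :=
  (quarkEquiv.symm.trans ((Equiv.refl (Fin Nf)).prodCongr ((sitePerm π).prodCongr (Equiv.refl (Fin 3 × Fin 4))))).trans
    quarkEquiv

/-- `quarkSitePerm` on an enumerated quark variable. [folklore] -/
@[simp] theorem quarkSitePerm_quarkEquiv (π : Equiv.Perm (Fin 4)) (f : Fin Nf) (x : TorusSite 4 L) (c : Fin 3 × Fin 4) :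
    quarkSitePerm Nf π (quarkEquiv (f, (x, c))) = quarkEquiv (f, (sitePerm π x, c)) := by
  simp [quarkSitePerm]

/-- The inverse of `quarkSitePerm` on an enumerated quark variable. [folklore] -/
@[simp] theorem quarkSitePerm_symm_quarkEquiv (π : Equiv.Perm (Fin 4)) (f : Fin Nf) (x : TorusSite 4 L)
    (c : Fin 3 × Fin 4) :
    (quarkSitePerm Nf π).symm (quarkEquiv (f, (x, c))) = quarkEquiv (f, ((sitePerm π).symm x, c)) := by
  rw [Equiv.symm_apply_eq, quarkSitePerm_quarkEquiv, Equiv.apply_symm_apply]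

/-- **The `N_f`-flavour Wilson matrix of the permuted gauge field**: `D[π·U] = ((1⊗S) D[U] (1⊗S')) ∘ (π⁻¹ × π⁻¹)` on the
quark index. [cite: MontvayMunster1994, §4.2 and §5.1] -/
theorem diracMatrix_configPerm {π : Equiv.Perm (Fin 4)} {S S' : Matrix (Fin 4) (Fin 4) ℂ} (hS : IsSpinorIntertwiner π S S')
    (U : GaugeConfig 4 L 𝔾) (mq : Fin Nf → ℝ) :
    diracMatrix (configPerm π U) mq =
      (spinBlock S * diracMatrix U mq * spinBlock S').submatrix (quarkSitePerm Nf π).symm (quarkSitePerm Nf π).symm := by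
  ext i j
  obtain ⟨⟨f, x, a, α⟩, rfl⟩ := quarkEquiv.surjective i
  obtain ⟨⟨g, y, b, β⟩, rfl⟩ := quarkEquiv.surjective j
  rw [Matrix.submatrix_apply, quarkSitePerm_symm_quarkEquiv, quarkSitePerm_symm_quarkEquiv, mul_spinBlock_apply]
  simp only [spinBlock_mul_apply, diracMatrix_apply_quarkEquiv]
  by_cases hfg : f = g
  · subst hfg
    simp only [if_true]
    have h := wilsonDirac_configPerm_apply (fundamentalRep (Fin 3)) hS U (mq f) 1 ((sitePerm π).symm x) ((sitePerm π).symm y)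
      a b α β
    rw [Equiv.apply_symm_apply, Equiv.apply_symm_apply] at h
    rw [h, Finset.sum_comm]
    refine Finset.sum_congr rfl fun β' _ => ?_
    rw [Finset.sum_mul]
  · simp only [if_neg hfg, zero_mul, mul_zero, Finset.sum_const_zero]

variable (Nf) in
/-- **The axis permutation acting on the quark Grassmann algebra**: the spin block substitution `ψ̄ ↦ ψ̄(1⊗S)`,
`ψ ↦ (1⊗S')ᵀψ` (a `GrassmannGaussianSymmetry.blockSubst`) followed by the relabelling of the sites by `π`.
[cite: MontvayMunster1994, §4.2 and §5.1] [cite: BerezinSecondQuant1966, Ch. I §3] -/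
def quarkAxisPerm (π : Equiv.Perm (Fin 4)) (S S' : Matrix (Fin 4) (Fin 4) ℂ) : FermiAlg Nf L →ₐ[ℂ] FermiAlg Nf L :=
  (ExteriorAlgebra.map (LinearMap.funLeft ℂ ℂ
      (toLex.symm.trans ((Equiv.sumCongr (quarkSitePerm Nf π) (quarkSitePerm Nf π)).trans
        (toLex : FermiIdx Nf L ⊕ FermiIdx Nf L ≃ FermiIdx Nf L ⊕ₗ FermiIdx Nf L))).symm)).comp
    (ExteriorAlgebra.map (blockSubst ℂ (spinBlock (Nf := Nf) (L := L) S) (spinBlock (Nf := Nf) (L := L) S')ᵀ))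

/-- The site relabelling acts on bilinears by reindexing the matrix. [folklore] -/
theorem map_funLeft_quarkSitePerm_quadratic (π : Equiv.Perm (Fin 4)) (A : Matrix (FermiIdx Nf L) (FermiIdx Nf L) ℂ) :
    ExteriorAlgebra.map (LinearMap.funLeft ℂ ℂ
      (toLex.symm.trans ((Equiv.sumCongr (quarkSitePerm Nf π) (quarkSitePerm Nf π)).trans
        (toLex : FermiIdx Nf L ⊕ FermiIdx Nf L ≃ FermiIdx Nf L ⊕ₗ FermiIdx Nf L))).symm) (quadratic ℂ A) =
      quadratic ℂ (A.submatrix (quarkSitePerm Nf π).symm (quarkSitePerm Nf π).symm) := by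
  have hb : ∀ i, ExteriorAlgebra.map (LinearMap.funLeft ℂ ℂ
      (toLex.symm.trans ((Equiv.sumCongr (quarkSitePerm Nf π) (quarkSitePerm Nf π)).trans
        (toLex : FermiIdx Nf L ⊕ FermiIdx Nf L ≃ FermiIdx Nf L ⊕ₗ FermiIdx Nf L))).symm) (psiBar ℂ i) =
      psiBar ℂ (quarkSitePerm Nf π i) := fun i => by
    rw [psiBar, map_funLeft_gen]; rfl
  have hp : ∀ i, ExteriorAlgebra.map (LinearMap.funLeft ℂ ℂ
      (toLex.symm.trans ((Equiv.sumCongr (quarkSitePerm Nf π) (quarkSitePerm Nf π)).trans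
        (toLex : FermiIdx Nf L ⊕ FermiIdx Nf L ≃ FermiIdx Nf L ⊕ₗ FermiIdx Nf L))).symm) (psi ℂ i) =
      psi ℂ (quarkSitePerm Nf π i) := fun i => by
    rw [psi, map_funLeft_gen]; rfl
  simp only [quadratic, map_sum, map_smul, map_mul, hb, hp]
  symm
  rw [← (quarkSitePerm Nf π).sum_comp]
  refine Finset.sum_congr rfl fun i _ => ?_
  rw [← (quarkSitePerm Nf π).sum_comp]
  refine Finset.sum_congr rfl fun j _ => ?_
  rw [Matrix.submatrix_apply, Equiv.symm_apply_apply, Equiv.symm_apply_apply]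

/-- **The fermionic Boltzmann factor is carried to the Boltzmann factor of the permuted gauge field.**
[cite: MontvayMunster1994, §4.2 and §5.1] -/
theorem quarkAxisPerm_fermiBoltzmann {π : Equiv.Perm (Fin 4)} {S S' : Matrix (Fin 4) (Fin 4) ℂ}
    (hS : IsSpinorIntertwiner π S S') (U : GaugeConfig 4 L 𝔾) (mq : Fin Nf → ℝ) :
    quarkAxisPerm Nf π S S' (fermiBoltzmann U mq) = fermiBoltzmann (configPerm π U) mq := by
  rw [quarkAxisPerm, AlgHom.comp_apply, fermiBoltzmann, fermiBoltzmann, map_blockSubst_grassmannExp_quadratic,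
    map_funLeft_grassmannExp, map_funLeft_quarkSitePerm_quadratic, Matrix.transpose_transpose, diracMatrix_configPerm hS,
    Matrix.mul_neg, Matrix.neg_mul, Matrix.submatrix_neg]
  rfl

/-- **The Berezin integral is invariant under the axis permutation** (Jacobian `det(1⊗S) det(1⊗S') = det(1⊗(S S')) = 1`
for the spin substitution, `(sign)² = 1` for the relabelling). [cite: BerezinSecondQuant1966, Ch. I §3] -/
theorem fermiIntegral_quarkAxisPerm {π : Equiv.Perm (Fin 4)} {S S' : Matrix (Fin 4) (Fin 4) ℂ}
    (hS : IsSpinorIntertwiner π S S') (y : FermiAlg Nf L) :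
    fermiIntegral (quarkAxisPerm Nf π S S' y) = fermiIntegral y := by
  rw [quarkAxisPerm, AlgHom.comp_apply, fermiIntegral]
  rw [berezin_map_of_det_eq_one ℂ, berezin_map_of_det_eq_one ℂ]
  · rw [det_blockSubst, Matrix.det_transpose, ← Matrix.det_mul, spinBlock_mul, hS.2, spinBlock_one, Matrix.det_one]
  · rw [det_funLeft_perm', Equiv.Perm.sign_symm,
      show (toLex.symm.trans ((Equiv.sumCongr (quarkSitePerm Nf π) (quarkSitePerm Nf π)).trans
        (toLex : FermiIdx Nf L ⊕ FermiIdx Nf L ≃ FermiIdx Nf L ⊕ₗ FermiIdx Nf L))) =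
        Equiv.permCongr toLex (Equiv.sumCongr (quarkSitePerm Nf π) (quarkSitePerm Nf π)) from rfl,
      Equiv.Perm.sign_permCongr, Equiv.Perm.sign_sumCongr, Int.units_mul_self, Units.val_one, Int.cast_one]

omit [NeZero L] in
/-- Permuting the axes back and forth. [folklore] -/
theorem configPerm_configPerm_symm {G : Type*} [MeasurableSpace G] (π : Equiv.Perm (Fin 4)) (U : GaugeConfig 4 L G) :
    configPerm π (configPerm π.symm U) = U := by
  funext e
  rw [configPerm_apply, configPerm_apply, Equiv.symm_symm]
  congr 1
  ext1
  · change sitePerm π (sitePerm π.symm e.1) = e.1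
    have := sitePerm_symm_sitePerm (L := L) π.symm e.1
    rwa [Equiv.symm_symm] at this
  · exact Equiv.apply_symm_apply π e.2

/-- **Torus Wilson integrals are invariant under permutations of the axes** (any integrand). [folklore] -/
theorem integral_comp_configPerm_wilson (β : ℝ) (π : Equiv.Perm (Fin 4)) (g : GaugeConfig 4 L 𝔾 → ℂ) :
    ∫ U, g (configPerm π U) ∂(wilsonMeasure (d := 4) (L := L) (fundamentalRep (Fin 3)) β) =
      ∫ U, g U ∂(wilsonMeasure (d := 4) (L := L) (fundamentalRep (Fin 3)) β) := by
  rw [← integral_map_equiv, wilsonMeasure_map_configPerm (fundamentalRep (Fin 3)) (continuous_fundamentalRep (Fin 3))]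

/-- **Covariance of the honest lattice-QCD functional under permutations of the axes** (signed determinant, any `β`,
all bare masses, every torus): with a spinor intertwiner `(S, S')` of `π`,
`⟨(π,S) · X(π⁻¹ ·)⟩_{β,S,m} = ⟨X⟩_{β,S,m}` for every Grassmann-valued `X`. [cite: MontvayMunster1994, §4.2 and §5.1] [cite: OsterwalderSeiler1978, §2] -/
theorem qcdTorusExpect_quarkAxisPerm {π : Equiv.Perm (Fin 4)} {S S' : Matrix (Fin 4) (Fin 4) ℂ}
    (hS : IsSpinorIntertwiner π S S') (β : ℝ) (mq : Fin Nf → ℝ) (X : GaugeConfig 4 L 𝔾 → FermiAlg Nf L) :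
    qcdTorusExpect β L mq (fun U => quarkAxisPerm Nf π S S' (X (configPerm π.symm U))) = qcdTorusExpect β L mq X := by
  unfold qcdTorusExpect
  congr 1
  have hB : ∀ U : GaugeConfig 4 L 𝔾,
      fermiBoltzmann U mq = quarkAxisPerm Nf π S S' (fermiBoltzmann (configPerm π.symm U) mq) := by
    intro U
    rw [quarkAxisPerm_fermiBoltzmann hS, configPerm_configPerm_symm]
  calc ∫ U, fermiIntegral (quarkAxisPerm Nf π S S' (X (configPerm π.symm U)) * fermiBoltzmann U mq)
          ∂(wilsonMeasure (d := 4) (L := L) (fundamentalRep (Fin 3)) β)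
      = ∫ U, (fun V => fermiIntegral (X V * fermiBoltzmann V mq)) (configPerm π.symm U)
          ∂(wilsonMeasure (d := 4) (L := L) (fundamentalRep (Fin 3)) β) := by
        refine integral_congr_ae (Filter.Eventually.of_forall fun U => ?_)
        simp only
        rw [hB U, ← map_mul, fermiIntegral_quarkAxisPerm hS]
    _ = ∫ U, fermiIntegral (X U * fermiBoltzmann U mq)
          ∂(wilsonMeasure (d := 4) (L := L) (fundamentalRep (Fin 3)) β) :=
        integral_comp_configPerm_wilson β π.symm (fun V => fermiIntegral (X V * fermiBoltzmann V mq))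

end Flavours

end Literature.MathematicalPhysics.QuantumFieldTheory

end
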